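import Mathlib
import HarnessLib
import Summits.NavierStokesRegularity.NavierStokesRegularity.Theorems.HalfSpaceWindowDoorCirculationCarryingRigidityConeFluxSubsolution
import Summits.NavierStokesRegularity.NavierStokesRegularity.Theorems.HalfSpaceWindowDoorCirculationCarryingRigidityWholeSpaceMaxPrinciple
import Summits.NavierStokesRegularity.NavierStokesRegularity.Theorems.HalfSpaceWindowDoorCirculationCarryingRigidityAngularMeanDrift
import Literature.Analysis.FluidPDE.MeridianReduction
import Summits.NavierStokesRegularity.NavierStokesRegularity.Theorems.HalfSpaceWindowDoorCirculationCarryingRigidityEddyMeans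
import Summits.NavierStokesRegularity.NavierStokesRegularity.Theorems.HalfSpaceWindowDoorCirculationCarryingRigidityTouchingMaxPrinciple
import Summits.NavierStokesRegularity.NavierStokesRegularity.Theorems.HalfSpaceWindowDoorCirculationCarryingRigidityFlatTools
import Summits.NavierStokesRegularity.NavierStokesRegularity.Theorems.HalfSpaceWindowDoorCirculationCarryingRigidityQuietTools
import Summits.NavierStokesRegularity.NavierStokesRegularity.Theorems.HalfSpaceWindowDoorCirculationCarryingRigidityQuietTouching
import Summits.NavierStokesRegularity.NavierStokesRegularity.Theorems.HalfSpaceWindowDoorCirculationCarryingRigidityMovingFrame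

/-!
# Route `HalfSpaceWindowDoor`, crux `CirculationCarryingRigidity` (stmt-25311) — line `eddy_covariance`, QUIET barrier in the MOVING FRAME
LEAD ns-hsw-p1 g10, `--supports 25311 --as helper`.  `…QuietBarrier.circ_le_of_quiet_aux` run for the moving profile `W(t,x) = v(t, x + √(−t)y₀)`
of `…MovingFrame` (a vertical axis fixed in SIMILARITY variables; `W` is not door class, but each slice is a slice of a door-class translate).
The only change in the mechanics is the MOVING FLUX `𝒳` of the circle law (`deriv_circ_moving_eq_remainder`), `𝒳 ≤ (‖y₀‖/2)/√(−t)(∮ω₃ dl + |∮ω_r dl|)`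
(`movingFlux_le`), absorbed in the drift like the eddy bound: drift constant `B' = B + ‖y₀‖/2`, tube radius `R₁ = 4(B'+C) + R₀ + 1 + 8πC/η₀`.
RESULT `circ_le_of_moving_aux`; W6 ⟸ the moving quiet eddy bound in `…MovingLiouville`.
WHAT THIS IS NOT: not about NS regularity; HYPOTHETICAL blow-up profiles (KNSS ancient mild solutions).  No item is closed here.
-/

noncomputable section

-- the summit and its single sub-problem share the name (CONVENTIONS §1), as in every Theorems file
set_option linter.dupNamespace false

namespace Summit.NavierStokesRegularity.NavierStokesRegularity.Theorems.HalfSpaceWindowDoorCirculationCarryingRigidityMovingBarrier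

open MeasureTheory Set Function Filter Topology InnerProductSpace
open scoped RealInnerProductSpace InnerProductSpace Laplacian
open Literature.Analysis Literature.Analysis.UnboundedOperators
open Literature.Analysis.FluidPDE hiding eR
open Summit.NavierStokesRegularity.NavierStokesRegularity.Theorems.HalfSpaceWindowDoorCirculationCarryingRigidityDefs (InDoorClass SignE3 e3)
open Summit.NavierStokesRegularity.NavierStokesRegularity.Theorems.AxisTwistDoorAveragedConeLiouvilleDefs
  (cylPt eT eR circ vortCirc radVortCirc tiltCirc circleTerm meanR meanZ remainder)
open Summit.NavierStokesRegularity.NavierStokesRegularity.Theorems.AveragedConeLiouville.CircleStokes (deriv_circ_eq_vortCirc)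
open Summit.NavierStokesRegularity.NavierStokesRegularity.Theorems.AveragedConeLiouville.CircMonotone (circ_nonneg vortCirc_nonneg)
open Summit.NavierStokesRegularity.NavierStokesRegularity.Theorems.HalfSpaceWindowDoorCirculationCarryingRigidityAxisCirculation
  (contDiff_circF isSmoothSpaceTimeOn_circF isSmoothSpaceTimeOn_of_class fderiv_circF_eR laplacian_circF hasDerivAt_circF_time)
open Summit.NavierStokesRegularity.NavierStokesRegularity.Theorems.HalfSpaceWindowDoorCirculationCarryingRigidityTouchingMaxPrinciple
  (le_of_subsolution_touching)
open Summit.NavierStokesRegularity.NavierStokesRegularity.Theorems.HalfSpaceWindowDoorCirculationCarryingRigidityFlatTools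
  (norm_drift_le barrier_slack_nonneg barrier_drift_mono far_of_comparison_pos sign_mult)
open Summit.NavierStokesRegularity.NavierStokesRegularity.Theorems.HalfSpaceWindowDoorCirculationCarryingRigidityQuietTools
  (quarter_at_self quarter_mul_sqrt_le_one hasDerivAt_quarter linear_barrier_slack_nonneg continuousOn_quarter_mul_cylRadius
    fderiv_mixed_barrier_dir contDiffAt_mixed_barrier laplacian_mixed_barrier)
open Summit.NavierStokesRegularity.NavierStokesRegularity.Theorems.HalfSpaceWindowDoorCirculationCarryingRigidityQuietTouching
  (circ_integrals_of_touching_lin quiet_r_bound quiet_z_bound)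
open Summit.NavierStokesRegularity.NavierStokesRegularity.Theorems.HalfSpaceWindowDoorCirculationCarryingRigidityConeFluxSubsolution
open Summit.NavierStokesRegularity.NavierStokesRegularity.Theorems.HalfSpaceWindowDoorCirculationCarryingRigidityEddyMeans
  (abs_meanR_le abs_meanZ_le fderiv_circF_eZ barrier_upper_bound)
open Summit.NavierStokesRegularity.NavierStokesRegularity.Theorems.HalfSpaceWindowDoorCirculationCarryingRigidityMovingFrame
  (inDoorClass_translate signE3_translate isSmoothSpaceTimeOn_moving deriv_circ_moving_eq_remainder movingFlux_le tube_bddAbove_moving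
    continuousOn_comparison_of_smooth)
open Summit.NavierStokesRegularity.NavierStokesRegularity.Theorems.FilamentPinchDoorFilamentPinchLiouvilleFarFieldFlux (curl_comp_add_right)
variable {C : ℝ} {v : ℝ → EuclideanSpace ℝ (Fin 3) → EuclideanSpace ℝ (Fin 3)}

set_option maxHeartbeats 4000000 in
/-- **Step 2 with the barrier, MOVING FRAME** (quiet form): for `W(t,x) = v(t, x + √(−t)y₀)`,
`Γ_W(r,z,s) ≤ μ + 2πC r/√(√(−s)√(−s₀)) + (η₀/8) r²/(√(−s)√(−s₀))` on `[s₀,s₁]`, `μ = sup{Γ_W(R₁√(−s'),z',s') : s' ≤ s₁}`,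
`R₁ = 4(B + ‖y₀‖/2 + C) + R₀ + 1 + 8πC/η₀`, from the EDDY bound `ℛ_W ≤ (B/√(−t))(∮ω₃ dl + |∮ω_r dl|)` required only at times `≤ s₁` on record
far circles about the moving axis that are QUIET and GROWING. -/
theorem circ_le_of_moving_aux (hv : InDoorClass C v) (hsign : SignE3 v) (y₀ : EuclideanSpace ℝ (Fin 3)) {B : ℝ} (hB0 : 0 ≤ B)
    {R₀ : ℝ} (hR₀ : 0 ≤ R₀) {s₀ s₁ : ℝ} (hs₀₁ : s₀ < s₁) (hs₁ : s₁ < 0) {η₀ : ℝ} (hη₀ : 0 < η₀)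
    (hed : ∀ t : ℝ, t ≤ s₁ → ∀ r : ℝ, R₀ * Real.sqrt (-t) ≤ r → ∀ z : ℝ,
      (∀ s' : ℝ, s' ≤ t → ∀ z' : ℝ,
        circ (fun τ x => v τ (x + Real.sqrt (-τ) • y₀))
          ((4 * (B + ‖y₀‖ / 2 + C) + R₀ + 1 + 8 * Real.pi * C / η₀) * Real.sqrt (-s')) z' s' <
          circ (fun τ x => v τ (x + Real.sqrt (-τ) • y₀)) r z t) →
      (-t) * vortCirc (fun τ x => v τ (x + Real.sqrt (-τ) • y₀)) r z t ≤ η₀ * r →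
      (-t) * |radVortCirc (fun τ x => v τ (x + Real.sqrt (-τ) • y₀)) r z t| ≤ η₀ * r →
      0 < deriv (fun σ => circ (fun τ x => v τ (x + Real.sqrt (-τ) • y₀)) r z σ) t →
      remainder (fun τ x => v τ (x + Real.sqrt (-τ) • y₀)) r z t ≤
        B / Real.sqrt (-t) * (vortCirc (fun τ x => v τ (x + Real.sqrt (-τ) • y₀)) r z t +
          |radVortCirc (fun τ x => v τ (x + Real.sqrt (-τ) • y₀)) r z t|)) :
    ∀ s ∈ Icc s₀ s₁, ∀ r : ℝ, 0 ≤ r → ∀ z : ℝ,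
      circ (fun τ x => v τ (x + Real.sqrt (-τ) • y₀)) r z s ≤
        sSup {m : ℝ | ∃ s' : ℝ, s' ≤ s₁ ∧ ∃ z' : ℝ,
          m = circ (fun τ x => v τ (x + Real.sqrt (-τ) • y₀))
            ((4 * (B + ‖y₀‖ / 2 + C) + R₀ + 1 + 8 * Real.pi * C / η₀) * Real.sqrt (-s')) z' s'} +
        2 * Real.pi * C * (Real.sqrt (Real.sqrt (-s) * Real.sqrt (-s₀)))⁻¹ * r +
        η₀ / 8 * r ^ 2 / (Real.sqrt (-s) * Real.sqrt (-s₀)) := by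
  set W : ℝ → EuclideanSpace ℝ (Fin 3) → EuclideanSpace ℝ (Fin 3) := fun τ x => v τ (x + Real.sqrt (-τ) • y₀) with hW
  have hsignW : SignE3 W := fun s hs y => by
    have e : curl (W s) y = curl (v s) (y + Real.sqrt (-s) • y₀) := curl_comp_add_right (v s) _ y
    rw [e]; exact hsign s hs (y + Real.sqrt (-s) • y₀)
  set B' : ℝ := B + ‖y₀‖ / 2 with hB'
  have hC : 0 ≤ C := HalfSpaceWindowDoorCirculationCarryingRigidityConeFluxSubsolution.typeI_const_nonneg hv
  set R₁ : ℝ := 4 * (B' + C) + R₀ + 1 + 8 * Real.pi * C / η₀ with hR₁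
  set A : ℝ := η₀ / 8 with hA
  set S : Set ℝ := {m : ℝ | ∃ s' : ℝ, s' ≤ s₁ ∧ ∃ z' : ℝ, m = circ W (R₁ * Real.sqrt (-s')) z' s'} with hS
  set μ : ℝ := sSup S with hμ
  have hs₀ : s₀ < 0 := hs₀₁.trans hs₁
  have hsq₀ : 0 < Real.sqrt (-s₀) := Real.sqrt_pos.2 (neg_pos.2 hs₀)
  have hsq₁ : 0 < Real.sqrt (-s₁) := Real.sqrt_pos.2 (neg_pos.2 hs₁)
  obtain ⟨hB'0, hR₁pos, hApos⟩ : 0 ≤ B' ∧ 0 < R₁ ∧ 0 < A := ⟨by positivity, by positivity, by positivity⟩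
  obtain ⟨hSbdd, hSle⟩ := tube_bddAbove_moving hv y₀ hR₁pos.le hs₁
  have hμ_ge : ∀ s' ≤ s₁, ∀ z', circ W (R₁ * Real.sqrt (-s')) z' s' ≤ μ := fun s' hs' z' =>
    le_csSup hSbdd ⟨s', hs', z', rfl⟩
  have hμ0 : 0 ≤ μ := by
    refine le_trans ?_ (hμ_ge s₁ le_rfl 0)
    have hW1 : ContDiff ℝ 1 (W s₁) := contDiff_one_slice (inDoorClass_translate hv (Real.sqrt (-s₁) • y₀)) hs₁
    exact circ_nonneg W hW1 (signE3_atd hsignW) hs₁ (by positivity) 0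
  have hsmv := isSmoothSpaceTimeOn_of_class hv.1 hv.2.1 hv.2.2.1 hv.2.2.2
  have hsm := isSmoothSpaceTimeOn_moving hsmv y₀; have hsmF := isSmoothSpaceTimeOn_circF hsm
  set F : ℝ → EuclideanSpace ℝ (Fin 3) → ℝ := fun t x => (2 * Real.pi)⁻¹ * circ W (cylRadius x) (x 2) t with hF
  set φ : ℝ → EuclideanSpace ℝ (Fin 3) → ℝ := fun t x =>
    (2 * Real.pi)⁻¹ * (μ + A * (Real.sqrt (-t) * Real.sqrt (-s₀))⁻¹ * (x 0 * x 0 + x 1 * x 1)) +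
      (C * (Real.sqrt (Real.sqrt (-t) * Real.sqrt (-s₀)))⁻¹) * cylRadius x with hφ
  set q : ℝ → EuclideanSpace ℝ (Fin 3) → ℝ := fun t x => F t x - φ t x with hq
  set β : ℝ → EuclideanSpace ℝ (Fin 3) → ℝ := fun t x =>
    if 0 ≤ radVortCirc W (cylRadius x) (x 2) t then B' / Real.sqrt (-t) else -(B' / Real.sqrt (-t)) with hβ
  set b : ℝ → EuclideanSpace ℝ (Fin 3) → EuclideanSpace ℝ (Fin 3) := fun t x =>
    (2 / cylRadius x - B' / Real.sqrt (-t) + meanR W (cylRadius x) (x 2) t) • Literature.Analysis.FluidPDE.eR x +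
      (meanZ W (cylRadius x) (x 2) t + β t x) • (eZ : EuclideanSpace ℝ (Fin 3)) with hb
  have h2π : 0 < 2 * Real.pi := by positivity
  have hLnn : ∀ t, 0 ≤ C * (Real.sqrt (Real.sqrt (-t) * Real.sqrt (-s₀)))⁻¹ := fun t => by positivity
  have hcontq : ContinuousOn (uncurry q) (Icc s₀ s₁ ×ˢ univ) := by
    have h1 := continuousOn_comparison_of_smooth (μ := μ) (A := A) hsm hs₀₁ hs₁
    have h2 := (continuousOn_quarter_mul_cylRadius (s₀ := s₀) hs₁ hs₀₁).const_smul C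
    refine (h1.sub h2).congr fun p _ => ?_; obtain ⟨t', x'⟩ := p
    simp only [hq, hF, hφ, uncurry, Pi.sub_apply, Pi.smul_apply, smul_eq_mul]
    ring
  have hBup : ∀ t ∈ Icc s₀ s₁, ∀ x, q t x ≤ Real.pi * (C / Real.sqrt (-s₁)) ^ 2 * (-s₀) / (2 * A) := by
    intro t ht x
    have h : (2 * Real.pi)⁻¹ * circ W (cylRadius x) (x 2) t -
        (2 * Real.pi)⁻¹ * (μ + A * (Real.sqrt (-t) * Real.sqrt (-s₀))⁻¹ * (x 0 * x 0 + x 1 * x 1)) ≤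
        Real.pi * (C / Real.sqrt (-s₁)) ^ 2 * (-s₀) / (2 * A) :=
      barrier_upper_bound (μ := μ) (inDoorClass_translate hv (Real.sqrt (-t) • y₀)) hμ0 hApos hs₀₁ hs₁ ht x
    have hpos : 0 ≤ C * (Real.sqrt (Real.sqrt (-t) * Real.sqrt (-s₀)))⁻¹ * cylRadius x :=
      mul_nonneg (hLnn t) (cylRadius_nonneg x)
    show F t x - φ t x ≤ _; simp only [hF, hφ]; linarith
  have hinit : ∀ x, q s₀ x ≤ 0 := by
    intro x
    have h1 : circ W (cylRadius x) (x 2) s₀ ≤ 2 * Real.pi * cylRadius x * (C / Real.sqrt (-s₀)) :=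
      circ_le_linear (inDoorClass_translate hv (Real.sqrt (-s₀) • y₀)) hs₀ (cylRadius_nonneg x) (x 2)
    have hq0 : 0 ≤ A * (Real.sqrt (-s₀) * Real.sqrt (-s₀))⁻¹ * (x 0 * x 0 + x 1 * x 1) := by
      have : 0 ≤ x 0 * x 0 + x 1 * x 1 := by nlinarith [sq_nonneg (x 0), sq_nonneg (x 1)]
      positivity
    show F s₀ x - φ s₀ x ≤ 0; simp only [hF, hφ, quarter_at_self]
    have h3 : (2 * Real.pi)⁻¹ * circ W (cylRadius x) (x 2) s₀ ≤ C * (Real.sqrt (-s₀))⁻¹ * cylRadius x := by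
      have := mul_le_mul_of_nonneg_left h1 (le_of_lt (inv_pos.2 h2π))
      refine this.trans (le_of_eq ?_); field_simp
    have h4 : 0 ≤ (2 * Real.pi)⁻¹ * (μ + A * (Real.sqrt (-s₀) * Real.sqrt (-s₀))⁻¹ * (x 0 * x 0 + x 1 * x 1)) := by positivity
    linarith
  set Λ : ℝ := (2 / R₁ + B') / Real.sqrt (-s₁) + C / Real.sqrt (-s₁) + (C / Real.sqrt (-s₁) + B' / Real.sqrt (-s₁)) with hΛ
  set E₁ : ℝ := Real.exp ((2 * Λ + 6) * (s₁ - s₀)) with hE₁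
  obtain ⟨hΛ0, hE₁pos⟩ : 0 ≤ Λ ∧ 0 < E₁ := ⟨by positivity, Real.exp_pos _⟩
  set Bup : ℝ := Real.pi * (C / Real.sqrt (-s₁)) ^ 2 * (-s₀) / (2 * A) with hBupdef
  have hBup0 : 0 ≤ Bup := by
    rw [hBupdef]; exact div_nonneg (mul_nonneg (mul_nonneg Real.pi_pos.le (sq_nonneg _)) (neg_pos.2 hs₀).le) (by positivity)
  have hns₀ : 0 < -s₀ := neg_pos.2 hs₀
  set ε₀ : ℝ := min (η₀ / (16 * Real.pi * E₁ * (-s₀))) (η₀ ^ 2 / (16 * Real.pi ^ 2 * E₁ ^ 2 * (-s₀) * (Bup + 1))) with hε₀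
  have hε₀pos : 0 < ε₀ := lt_min (by positivity) (by positivity)
  have hε₀1 : ε₀ ≤ η₀ / (16 * Real.pi * E₁ * (-s₀)) := min_le_left _ _
  have hε₀2 : ε₀ ≤ η₀ ^ 2 / (16 * Real.pi ^ 2 * E₁ ^ 2 * (-s₀) * (Bup + 1)) := min_le_right _ _
  have hsub : ∀ t ∈ Ioc s₀ s₁, ∀ x, 0 < q t x →
      ‖b t x‖ ≤ Λ ∧
      (∃ U : Set (EuclideanSpace ℝ (Fin 3)), IsOpen U ∧ x ∈ U ∧ ContDiffOn ℝ 2 (q t) U) ∧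
      (∃ d : ℝ, HasDerivAt (fun τ => q τ x) d t ∧
        (0 < d → ∀ ε : ℝ, 0 < ε → ε ≤ ε₀ → ε * (1 + ‖x‖ ^ 2) ≤ q t x - 0 →
          fderiv ℝ (q t) x = ε • (Real.exp ((2 * Λ + 6) * (t - s₀)) • ((2 : ℝ) • innerSL ℝ x)) →
          d + fderiv ℝ (q t) x (b t x) - (Δ (q t)) x ≤ 0)) := by
    intro t ht x hqpos
    have ht0 : t < 0 := lt_of_le_of_lt ht.2 hs₁
    have hsqt : 0 < Real.sqrt (-t) := Real.sqrt_pos.2 (neg_pos.2 ht0)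
    have hwt := inDoorClass_translate hv (Real.sqrt (-t) • y₀)
    have hst := signE3_translate hsign (Real.sqrt (-t) • y₀)
    have hv1 : ContDiff ℝ 1 (W t) := contDiff_one_slice hwt ht0
    set ρ := cylRadius x with hρ; have hρ0 : 0 ≤ ρ := cylRadius_nonneg x
    have hρ2 : ρ ^ 2 = x 0 * x 0 + x 1 * x 1 := by rw [cylRadius_sq x]; ring
    set κ : ℝ := A * (Real.sqrt (-t) * Real.sqrt (-s₀))⁻¹ with hκ
    have hκ0 : 0 ≤ κ := by positivity
    set Lt : ℝ := C * (Real.sqrt (Real.sqrt (-t) * Real.sqrt (-s₀)))⁻¹ with hLt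
    have hLt0 : 0 ≤ Lt := hLnn t
    have hqpos' : 0 < (2 * Real.pi)⁻¹ * circ W (cylRadius x) (x 2) t - (2 * Real.pi)⁻¹ * (μ + κ * (x 0 * x 0 + x 1 * x 1)) := by
      have e : q t x = (2 * Real.pi)⁻¹ * circ W (cylRadius x) (x 2) t - (2 * Real.pi)⁻¹ * (μ + κ * (x 0 * x 0 + x 1 * x 1)) -
          Lt * cylRadius x := by simp only [hq, hF, hφ, hκ, hLt]; ring
      have : 0 ≤ Lt * cylRadius x := mul_nonneg hLt0 (cylRadius_nonneg x)
      linarith [hqpos, e.le, e.ge]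
    have hρR : R₁ * Real.sqrt (-t) < ρ := far_of_comparison_pos hwt hst ht0 hκ0 (hμ_ge t ht.2 (x 2)) hqpos'
    have hρpos : 0 < ρ := lt_of_le_of_lt (by positivity) hρR
    have hρne : cylRadius x ≠ 0 := hρpos.ne'
    have hR₁ge : 4 * (B' + C) ≤ R₁ ∧ R₀ ≤ R₁ ∧ 1 ≤ R₁ := by
      have h8 : 0 ≤ 8 * Real.pi * C / η₀ := by positivity
      have hBC : 0 ≤ 4 * (B' + C) := by positivity
      refine ⟨?_, ?_, ?_⟩ <;> rw [hR₁] <;> linarith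
    have hρ4B : 4 * (B' + C) * Real.sqrt (-t) ≤ ρ :=
      (mul_le_mul_of_nonneg_right hR₁ge.1 hsqt.le).trans hρR.le
    have hmR : |meanR W ρ (x 2) t| ≤ C / Real.sqrt (-t) := abs_meanR_le hwt ht0 ρ (x 2)
    have hmZ : |meanZ W ρ (x 2) t| ≤ C / Real.sqrt (-t) := abs_meanZ_le hwt ht0 ρ (x 2)
    obtain ⟨hβabs, hβmul⟩ : |β t x| = B' / Real.sqrt (-t) ∧
        β t x * radVortCirc W ρ (x 2) t = B' / Real.sqrt (-t) * |radVortCirc W ρ (x 2) t| := by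
      simp only [hβ, hρ]; exact sign_mult (by positivity)
    have hφfun : φ t = fun y : EuclideanSpace ℝ (Fin 3) => (2 * Real.pi)⁻¹ * (μ + κ * (y 0 * y 0 + y 1 * y 1)) + Lt * cylRadius y := by
      funext y; simp only [hφ, hκ, hLt]
    have hφAt : ∀ y : EuclideanSpace ℝ (Fin 3), cylRadius y ≠ 0 → ContDiffAt ℝ 2 (φ t) y := fun y hy => by
      rw [hφfun]; exact contDiffAt_mixed_barrier hy μ κ Lt
    refine ⟨?_, ⟨{y | cylRadius y ≠ 0}, isOpen_ne_fun Literature.Analysis.FluidPDE.continuous_cylRadius continuous_const, hρne, ?_⟩, ?_⟩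
    · have h1 := norm_radialDrift_le hB'0 hR₁pos hs₁ ht.2 hρR
      have hs₁t : Real.sqrt (-s₁) ≤ Real.sqrt (-t) := Real.sqrt_le_sqrt (by linarith [ht.2])
      have hCt : C / Real.sqrt (-t) ≤ C / Real.sqrt (-s₁) := div_le_div_of_nonneg_left hC hsq₁ hs₁t
      have hBt : B' / Real.sqrt (-t) ≤ B' / Real.sqrt (-s₁) := div_le_div_of_nonneg_left hB'0 hsq₁ hs₁t
      have h := norm_drift_le x h1 (hmR.trans hCt) (hmZ.trans hCt) ((le_of_eq hβabs).trans hBt)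
      simpa only [hb, hρ, hΛ] using h
    · have hF2 : ContDiff ℝ 2 (F t) := contDiff_circF ((hsm.contDiff_slice ht0).of_le (by norm_cast))
      exact fun y hy => (hF2.contDiffAt.sub (hφAt y hy)).contDiffWithinAt
    · have hF2 : ContDiff ℝ 2 (F t) := contDiff_circF ((hsm.contDiff_slice ht0).of_le (by norm_cast))
      have hFt := hasDerivAt_circF_time hsm ht0 x
      have hlaw := deriv_circ_moving_eq_remainder hv y₀ ht0 hρpos (x 2)
      have hX := movingFlux_le hv hsign y₀ ht0 hρ0 (x 2)
      set X : ℝ := ∫ θ in (0 : ℝ)..(2 * Real.pi),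
        ⟪fderiv ℝ (fun x => v t (x + Real.sqrt (-t) • y₀)) (cylPt ρ θ (x 2)) ((-1 / (2 * Real.sqrt (-t))) • y₀), eT θ⟫_ℝ * ρ
        with hXdef
      set D : ℝ := -(-(1 / (2 * Real.sqrt (-t))) * Real.sqrt (-s₀)) / (Real.sqrt (-t) * Real.sqrt (-s₀)) ^ 2 with hDdef
      have hφt : HasDerivAt (fun τ => φ τ x) ((2 * Real.pi)⁻¹ * (A * D * (x 0 * x 0 + x 1 * x 1)) +
          C * ((Real.sqrt (Real.sqrt (-t) * Real.sqrt (-s₀)))⁻¹ / (4 * (-t))) * ρ) t :=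
        (((((hasDerivAt_invSqrt_mul ht0 hs₀).const_mul A).mul_const (x 0 * x 0 + x 1 * x 1)).const_add μ).const_mul
          ((2 * Real.pi)⁻¹)).add (((hasDerivAt_quarter ht0 hs₀).const_mul C).mul_const ρ)
      have hAD : A * D = κ / (2 * (-t)) := by
        have htt : Real.sqrt (-t) ^ 2 = -t := Real.sq_sqrt (neg_pos.2 ht0).le
        rw [hκ, hDdef]
        exact barrier_deriv_aux A _ _ _ hsqt hsq₀ htt
      set a : ℝ := 2 / ρ - B' / Real.sqrt (-t) + meanR W ρ (x 2) t with ha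
      set c : ℝ := meanZ W ρ (x 2) t + β t x with hc
      have hbdef : b t x = a • Literature.Analysis.FluidPDE.eR x + c • (eZ : EuclideanSpace ℝ (Fin 3)) := by
        simp only [hb, ha, hc, hρ]
      have hφdiff : DifferentiableAt ℝ (φ t) x := by rw [hφfun]; exact (fderiv_mixed_barrier_dir hρne μ κ Lt 0 0).1
      have hφ_dir : ∀ a' c' : ℝ, fderiv ℝ (φ t) x (a' • Literature.Analysis.FluidPDE.eR x + c' • (eZ : EuclideanSpace ℝ (Fin 3))) =
          (2 * Real.pi)⁻¹ * (κ * (a' * (2 * ρ))) + Lt * a' := fun a' c' => by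
        rw [hφfun, hρ]; exact (fderiv_mixed_barrier_dir hρne μ κ Lt a' c').2
      have hφ_fd : fderiv ℝ (φ t) x (b t x) = (2 * Real.pi)⁻¹ * (κ * (a * (2 * ρ))) + Lt * a := by rw [hbdef]; exact hφ_dir a c
      have hφ_lap : (Δ (φ t)) x = (2 * Real.pi)⁻¹ * (κ * 4) + Lt * ρ⁻¹ := by
        rw [hφfun, hρ]; exact laplacian_mixed_barrier hρne μ κ Lt
      have hFr := fderiv_circF_eR hsm ht0 x; have hFz := fderiv_circF_eZ hsm ht0 hρne; have hFΔ := laplacian_circF hsm ht0 hρne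
      have hFb : fderiv ℝ (F t) x (b t x) = a * ((2 * Real.pi)⁻¹ * vortCirc W ρ (x 2) t) +
          c * (-((2 * Real.pi)⁻¹ * radVortCirc W ρ (x 2) t)) := by
        rw [hbdef, map_add, map_smul, map_smul, smul_eq_mul, smul_eq_mul]
        show a * fderiv ℝ (F t) x (Literature.Analysis.FluidPDE.eR x) + c * fderiv ℝ (F t) x eZ = _
        rw [hFr, hFz]
      have hΔq : (Δ (q t)) x = (Δ (F t)) x - (Δ (φ t)) x :=
        ContDiffAt.laplacian_sub hF2.contDiffAt (hφAt x hρne)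
      have hDq : fderiv ℝ (q t) x (b t x) = fderiv ℝ (F t) x (b t x) - fderiv ℝ (φ t) x (b t x) := by
        have e : q t = fun y => F t y - φ t y := rfl
        rw [e, fderiv_fun_sub ((hF2.differentiable (by norm_num)).differentiableAt) hφdiff]
        rfl
      have hFΔ' : (Δ (F t)) x = (2 * Real.pi)⁻¹ * (deriv (fun r' => deriv (fun r'' => circ W r'' (x 2) t) r') ρ
          + ρ⁻¹ * deriv (fun r' => circ W r' (x 2) t) ρ
          + deriv (fun z' => deriv (fun z'' => circ W ρ z'' t) z') (x 2)) := hFΔ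
      rw [← hρ] at hFt
      refine ⟨_, hFt.sub hφt, fun hdpos ε hε hεε₀ hεq hgradq => ?_⟩
      set E : ℝ := Real.exp ((2 * Λ + 6) * (t - s₀)) with hE; have hEpos : 0 < E := Real.exp_pos _
      have hEE₁ : E ≤ E₁ := Real.exp_le_exp.2 (mul_le_mul_of_nonneg_left (sub_le_sub_right ht.2 s₀) (by positivity))
      have hgrad' : fderiv ℝ (fun y : EuclideanSpace ℝ (Fin 3) =>
          (2 * Real.pi)⁻¹ * circ W (cylRadius y) (y 2) t -
            (2 * Real.pi)⁻¹ * (μ + κ * (y 0 * y 0 + y 1 * y 1) + (2 * Real.pi * Lt) * cylRadius y)) x =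
          ε • (E • ((2 : ℝ) • innerSL ℝ x)) := by
        have e : (fun y : EuclideanSpace ℝ (Fin 3) =>
            (2 * Real.pi)⁻¹ * circ W (cylRadius y) (y 2) t -
              (2 * Real.pi)⁻¹ * (μ + κ * (y 0 * y 0 + y 1 * y 1) + (2 * Real.pi * Lt) * cylRadius y)) = q t := by
          funext y; simp only [hq, hF, hφ, hκ, hLt]; field_simp
        rw [e, hgradq]
      obtain ⟨hΓr_eq, hΓz_eq⟩ :
          vortCirc W (cylRadius x) (x 2) t = (4 * Real.pi * ε * E + 2 * κ) * cylRadius x + 2 * Real.pi * Lt ∧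
          radVortCirc W (cylRadius x) (x 2) t = -(4 * Real.pi * ε * E * x 2) :=
        circ_integrals_of_touching_lin hwt ht0 hρne hgrad'
      rw [← hρ] at hΓr_eq hΓz_eq
      have hquietR : (-t) * vortCirc W ρ (x 2) t ≤ η₀ * ρ := by
        rw [hΓr_eq]
        have hεE : 4 * Real.pi * ε * E * (-t) ≤ η₀ / 4 := by
          have h1 : 4 * Real.pi * ε * E * (-t) ≤ 4 * Real.pi * ε₀ * E₁ * (-s₀) := by
            have : (-t) ≤ (-s₀) := by linarith [ht.1]
            have h2 : ε * E ≤ ε₀ * E₁ := mul_le_mul hεε₀ hEE₁ hEpos.le hε₀pos.le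
            have h3 : ε * E * (-t) ≤ ε₀ * E₁ * (-s₀) := mul_le_mul h2 this (neg_pos.2 ht0).le (by positivity)
            nlinarith [Real.pi_pos, h3]
          have hden : 0 < 16 * Real.pi * E₁ * (-s₀) := mul_pos (mul_pos (mul_pos (by norm_num) Real.pi_pos) hE₁pos) hns₀
          have h4 : ε₀ * (16 * Real.pi * E₁ * (-s₀)) ≤ η₀ := (le_div_iff₀ hden).1 hε₀1
          have e4 : 4 * Real.pi * ε₀ * E₁ * (-s₀) = ε₀ * (16 * Real.pi * E₁ * (-s₀)) / 4 := by ring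
          linarith
        have hQle := quarter_mul_sqrt_le_one (s₀ := s₀) ht0 ht.1.le
        have hR₁C : 2 * Real.pi * C ≤ η₀ / 4 * R₁ := by
          have e : η₀ / 4 * (4 * (B' + C) + R₀ + 1 + 8 * Real.pi * C / η₀) = η₀ / 4 * (4 * (B' + C) + R₀ + 1) + 2 * Real.pi * C := by
            field_simp; ring
          have : 0 ≤ η₀ / 4 * (4 * (B' + C) + R₀ + 1) := by positivity
          rw [hR₁, e]; linarith
        have h := quiet_r_bound (θ := A) (C' := C) (Q := (Real.sqrt (Real.sqrt (-t) * Real.sqrt (-s₀)))⁻¹)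
          ht0 ht.1.le hη₀ hρ0 hA hεE hC hQle hR₁C hρR.le
        have e3 : 2 * Real.pi * C * (Real.sqrt (Real.sqrt (-t) * Real.sqrt (-s₀)))⁻¹ = 2 * Real.pi * Lt := by rw [hLt, mul_assoc]
        rw [e3, ← hκ] at h
        exact h
      have hquietZ : (-t) * |radVortCirc W ρ (x 2) t| ≤ η₀ * ρ := by
        have hx2 : |x 2| ≤ ‖x‖ := by simpa using PiLp.norm_apply_le x 2
        have hq_le : q t x ≤ Bup := hBup t ⟨ht.1.le, ht.2⟩ x
        have hεq' : ε * (1 + ‖x‖ ^ 2) ≤ Bup := by rw [sub_zero] at hεq; exact hεq.trans hq_le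
        have hρσ : Real.sqrt (-t) ≤ ρ := (le_mul_of_one_le_left hsqt.le hR₁ge.2.2).trans hρR.le
        rw [hΓz_eq, abs_neg, abs_mul, abs_of_nonneg (by positivity : 0 ≤ 4 * Real.pi * ε * E)]
        exact quiet_z_bound ht0 ht.1.le hη₀ (norm_nonneg x) hx2 hε.le hεε₀ hεq' hBup0 hEpos.le hEE₁ hE₁pos hε₀2 hρσ
      have hgrow : 0 < deriv (fun σ => circ W ρ (x 2) σ) t := by
        have h2t : 0 < 2 * (-t) := mul_pos two_pos (neg_pos.2 ht0)
        have h4t : 0 < 4 * (-t) := by linarith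
        have hφt0 : 0 ≤ (2 * Real.pi)⁻¹ * (A * D * (x 0 * x 0 + x 1 * x 1)) +
            C * ((Real.sqrt (Real.sqrt (-t) * Real.sqrt (-s₀)))⁻¹ / (4 * (-t))) * ρ := by
          rw [show A * D * (x 0 * x 0 + x 1 * x 1) = (A * D) * (x 0 * x 0 + x 1 * x 1) by ring, hAD, ← hρ2]
          exact add_nonneg (mul_nonneg (by positivity) (mul_nonneg (div_nonneg hκ0 h2t.le) (sq_nonneg _)))
            (mul_nonneg (mul_nonneg hC (div_nonneg (by positivity) h4t.le)) hρ0)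
        have h' := add_pos_of_pos_of_nonneg hdpos hφt0
        rw [sub_add_cancel] at h'
        exact (mul_pos_iff_of_pos_left (by positivity : (0:ℝ) < (2 * Real.pi)⁻¹)).1 h'
      have hρR₀ : R₀ * Real.sqrt (-t) ≤ ρ := (mul_le_mul_of_nonneg_right hR₁ge.2.1 hsqt.le).trans hρR.le
      have hΓμ : μ < circ W ρ (x 2) t := by
        have hq' : 0 < (2 * Real.pi)⁻¹ * (circ W ρ (x 2) t - (μ + κ * (x 0 * x 0 + x 1 * x 1))) := by
          rw [mul_sub]; exact hqpos'
        have hQ0 : 0 ≤ κ * (x 0 * x 0 + x 1 * x 1) := by rw [← hρ2]; positivity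
        have := (mul_pos_iff_of_pos_left (by positivity : (0:ℝ) < (2 * Real.pi)⁻¹)).1 hq'
        linarith
      have hStep1 := hed t ht.2 ρ hρR₀ (x 2) (fun s' hs' z' => lt_of_le_of_lt (hμ_ge s' (hs'.trans ht.2) z') hΓμ)
        hquietR hquietZ hgrow
      have hΓr0 : 0 ≤ vortCirc W ρ (x 2) t := vortCirc_nonneg W (signE3_atd hsignW) ht0 hρ0 _
      have hΓr' : deriv (fun r' => circ W r' (x 2) t) ρ = vortCirc W ρ (x 2) t := deriv_circ_eq_vortCirc W hv1 ρ (x 2)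
      rw [hDq, hΔq, hFb, hφ_fd, hφ_lap, hFΔ', hlaw, hΓr']
      set Γr := vortCirc W ρ (x 2) t with hΓr
      set ϱ := radVortCirc W ρ (x 2) t with hϱ
      set Γrr := deriv (fun r' => deriv (fun r'' => circ W r'' (x 2) t) r') ρ
      set Γzz := deriv (fun z' => deriv (fun z'' => circ W ρ z'' t) z') (x 2)
      set Rm := remainder W ρ (x 2) t with hRm
      set mR := meanR W ρ (x 2) t with hmRdef
      set mZ := meanZ W ρ (x 2) t with hmZdef
      have hbar := barrier_slack_nonneg (X := x 0 * x 0 + x 1 * x 1) ht0 hκ0 hρpos hρ2.symm hAD hρ4B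
      have hmean_bar : (2 * Real.pi)⁻¹ * (κ * ((2 / ρ - (B' + C) / Real.sqrt (-t)) * (2 * ρ))) ≤
          (2 * Real.pi)⁻¹ * (κ * (a * (2 * ρ))) := by
        refine barrier_drift_mono hκ0 hρ0 ?_
        rw [ha]
        have := (abs_le.1 hmR).1
        have e : (B' + C) / Real.sqrt (-t) = B' / Real.sqrt (-t) + C / Real.sqrt (-t) := by rw [add_div]
        linarith
      have hT : Rm ≤ B / Real.sqrt (-t) * (Γr + |ϱ|) := hStep1
      have hX' : X ≤ ‖y₀‖ / (2 * Real.sqrt (-t)) * (Γr + |ϱ|) := hX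
      have hTX : Rm + X ≤ B' / Real.sqrt (-t) * (Γr + |ϱ|) := by
        have e : B' / Real.sqrt (-t) * (Γr + |ϱ|) = B / Real.sqrt (-t) * (Γr + |ϱ|) + ‖y₀‖ / (2 * Real.sqrt (-t)) * (Γr + |ϱ|) := by
          rw [hB']; field_simp
        rw [e]; exact add_le_add hT hX'
      have hβϱ : β t x * ϱ = B' / Real.sqrt (-t) * |ϱ| := hβmul
      have hcϱ : c * ϱ = mZ * ϱ + B' / Real.sqrt (-t) * |ϱ| := by rw [hc, add_mul, hβϱ]
      set Qt : ℝ := (Real.sqrt (Real.sqrt (-t) * Real.sqrt (-s₀)))⁻¹ with hQt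
      have hlin := linear_barrier_slack_nonneg (L := Lt) (B' := B' + C) ht0 hLt0 hρpos hρ4B
      have hlin_mono : (2 / ρ - (B' + C) / Real.sqrt (-t)) * Lt ≤ a * Lt := by
        refine mul_le_mul_of_nonneg_right ?_ hLt0
        rw [ha]
        have := (abs_le.1 hmR).1
        have e : (B' + C) / Real.sqrt (-t) = B' / Real.sqrt (-t) + C / Real.sqrt (-t) := by rw [add_div]
        linarith
      have hLt' : C * (Qt / (4 * (-t))) * ρ = Lt / (4 * (-t)) * ρ := by rw [hLt]; ring
      have key : (2 * Real.pi)⁻¹ * (Γrr - ρ⁻¹ * Γr + Γzz + Rm - mR * Γr + mZ * ϱ + X) -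
          ((2 * Real.pi)⁻¹ * (A * D * (x 0 * x 0 + x 1 * x 1)) + C * (Qt / (4 * (-t))) * ρ) +
          (a * ((2 * Real.pi)⁻¹ * Γr) + c * (-((2 * Real.pi)⁻¹ * ϱ)) - ((2 * Real.pi)⁻¹ * (κ * (a * (2 * ρ))) + Lt * a)) -
          ((2 * Real.pi)⁻¹ * (Γrr + ρ⁻¹ * Γr + Γzz) - ((2 * Real.pi)⁻¹ * (κ * 4) + Lt * ρ⁻¹)) =
          (2 * Real.pi)⁻¹ * ((Rm + X) - B' / Real.sqrt (-t) * (Γr + |ϱ|)) -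
          ((2 * Real.pi)⁻¹ * (A * D * (x 0 * x 0 + x 1 * x 1))
            + (2 * Real.pi)⁻¹ * (κ * (a * (2 * ρ))) - (2 * Real.pi)⁻¹ * (κ * 4)) -
          (Lt / (4 * (-t)) * ρ + a * Lt - Lt * ρ⁻¹) := by
        rw [show c * (-((2 * Real.pi)⁻¹ * ϱ)) = -((2 * Real.pi)⁻¹ * (c * ϱ)) by ring, hcϱ, ha, hLt']
        field_simp; ring
      rw [key]
      have h1 : (2 * Real.pi)⁻¹ * ((Rm + X) - B' / Real.sqrt (-t) * (Γr + |ϱ|)) ≤ 0 :=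
        mul_nonpos_of_nonneg_of_nonpos (by positivity) (by linarith)
      linarith
  have hmp := le_of_subsolution_touching (m := 0) hΛ0 hε₀pos hcontq hBup hinit hsub
  intro s hs r hr z
  have hsqs : 0 < Real.sqrt (-s) := Real.sqrt_pos.2 (neg_pos.2 (lt_of_le_of_lt hs.2 hs₁))
  have hx := hmp s hs (cylPt r 0 z)
  have hrad : cylRadius (cylPt r 0 z) = r := by rw [cylRadius]; simp [cylPt, Real.sqrt_sq hr]
  have hz : (cylPt r 0 z) 2 = z := by simp [cylPt]
  have h0 : (cylPt r 0 z) 0 * (cylPt r 0 z) 0 + (cylPt r 0 z) 1 * (cylPt r 0 z) 1 = r ^ 2 := by simp [cylPt]; ring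
  have hq' : (2 * Real.pi)⁻¹ * circ W r z s -
      ((2 * Real.pi)⁻¹ * (μ + A * (Real.sqrt (-s) * Real.sqrt (-s₀))⁻¹ * r ^ 2) +
        C * (Real.sqrt (Real.sqrt (-s) * Real.sqrt (-s₀)))⁻¹ * r) ≤ 0 := by
    change (2 * Real.pi)⁻¹ * circ W (cylRadius (cylPt r 0 z)) ((cylPt r 0 z) 2) s -
      ((2 * Real.pi)⁻¹ * (μ + A * (Real.sqrt (-s) * Real.sqrt (-s₀))⁻¹ *
        ((cylPt r 0 z) 0 * (cylPt r 0 z) 0 + (cylPt r 0 z) 1 * (cylPt r 0 z) 1)) +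
        C * (Real.sqrt (Real.sqrt (-s) * Real.sqrt (-s₀)))⁻¹ * cylRadius (cylPt r 0 z)) ≤ 0 at hx
    rwa [hrad, hz, h0] at hx
  have h2π : 0 < 2 * Real.pi := by positivity
  have e : (2 * Real.pi)⁻¹ * circ W r z s -
      ((2 * Real.pi)⁻¹ * (μ + A * (Real.sqrt (-s) * Real.sqrt (-s₀))⁻¹ * r ^ 2) +
        C * (Real.sqrt (Real.sqrt (-s) * Real.sqrt (-s₀)))⁻¹ * r) =
      (2 * Real.pi)⁻¹ * (circ W r z s - (μ + 2 * Real.pi * C * (Real.sqrt (Real.sqrt (-s) * Real.sqrt (-s₀)))⁻¹ * r +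
        η₀ / 8 * r ^ 2 / (Real.sqrt (-s) * Real.sqrt (-s₀)))) := by
    rw [hA]; field_simp; ring
  rw [e] at hq'
  rcases mul_nonpos_iff.1 hq' with ⟨-, h2⟩ | ⟨h1, -⟩
  · linarith
  · exact absurd h1 (not_le.2 (by positivity))

end Summit.NavierStokesRegularity.NavierStokesRegularity.Theorems.HalfSpaceWindowDoorCirculationCarryingRigidityMovingBarrier

end
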